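import Literature.Barriers.CriticalPhenomena.WeaklySAWProgressiveIntegration
import Literature.MathematicalPhysics.QuantumLattice.GrassmannGaussianMoments
import Literature.MathematicalPhysics.QuantumLattice.GrassmannGaussianChargeRule
import HarnessLib

/-!
# `E_Cθ τ_x = τ_x`: the Gaussian super-convolution fixes `τ_x` (supersymmetry check)

Bauerschmidt–Brydges–Slade, CMP 337 (2015), arXiv:1403.7422, §4.1 and §5.1: the Gaussian
super-expectation `E_Cθ` integrates the fluctuation fields `(ξ, η)` of `θF(φ,ψ) = F(φ+ξ, ψ+η)`. For
the basic supersymmetric form `τ_x = φ_xφ̄_x + ψ_xψ̄_x` this gives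
`E_Cθ τ_x = τ_x + E_C(ξ_xξ̄_x) + E_C(η_xη̄_x) = τ_x + C_{xx} - C_{xx} = τ_x` (odd moments vanish;
the bosonic and fermionic two-point functions cancel — [BIS09], Proposition 4.1 and (F0),
`superIntegral_tau_mul_superGauss`). This file proves it for `convTheta`
(`WeaklySAWFluctuationIntegral.lean`), real symmetric positive-definite `A = C⁻¹`, as a consistency
certificate of the normalisations and signs of `E_Cθ` (bosonic `det A/π^{|Λ|}`, fermionic `ε`, the
transpose in `e^{-ψAψ̄} = e^{ψ̄Aᵀψ}`):

* `convTheta_add` (additivity of `E_Cθ` on forms with integrable shifted coefficients),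
  `gaussConvolution_const`, `gaussConvolution_normSq` (`μ_C * |φ_x|² = |φ_x|² + C_{xx}`, odd moments
  vanish by `ξ ↦ -ξ`);
* `convTheta_coeffMap_constHom` (`E_Cθ` on forms with constant coefficients is the normalised
  fermionic convolution `Γ_{Aᵀ}`), `gaussConvOn_psi_mul_psiBar`
  (`Γ_{Aᵀ}(ψ_xψ̄_x) = ε det A · ψ_xψ̄_x - ε adj(A)_{xx}` by the charge rule and the fermionic two-point
  function), `convTheta_psi_mul_psiBar` (`E_Cθ(ψ_xψ̄_x) = ψ_xψ̄_x - C_{xx}`);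
* **`convTheta_tau`**: `E_Cθ τ_x = τ_x`.

Everything is proved; no named facts.
-/

noncomputable section

open MeasureTheory Complex ComplexConjugate Filter
open Literature.MathematicalPhysics.QuantumLattice
open Literature.MathematicalPhysics.QuantumLattice.GrassmannAlgebra (berezin gen coeffMap grassmannBasis berezinOn)
open scoped BigOperators

namespace Literature.MathematicalPhysics.QuantumLattice

namespace GrassmannAlgebra

variable {R : Type*} [CommRing R] {κ : Type*} [LinearOrder κ] [Fintype κ] {J : Type*} [LinearOrder J] [Fintype J]

/-- Coordinates are transported along an embedding of generators: the coefficient of `θ_{e(s)}` in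
`e_* y` is the coefficient of `θ_s` in `y`. [folklore] -/
theorem repr_map_extendByZero_map (e : κ ↪o J) (y : GrassmannAlgebra R κ) (s : Finset κ) :
    (grassmannBasis R J).repr (ExteriorAlgebra.map (Function.ExtendByZero.linearMap R e) y) (s.map e.toEmbedding) =
      (grassmannBasis R κ).repr y s := by
  classical
  conv_lhs => rw [← (grassmannBasis R κ).sum_repr y]
  simp only [map_sum, map_smul, map_extendByZero_grassmannBasis, Module.Basis.repr_self, Finsupp.coe_finsetSum,
    Finset.sum_apply, Finsupp.smul_apply, Finsupp.single_apply, (Finset.map_injective e.toEmbedding).eq_iff,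
    smul_eq_mul, mul_ite, mul_one, mul_zero, Finset.sum_ite_eq', Finset.mem_univ, if_true]

end GrassmannAlgebra

end Literature.MathematicalPhysics.QuantumLattice

namespace Literature.Barriers.CriticalPhenomena

namespace CTWSAW

section TauCheck

variable {Λ : Type*} [LinearOrder Λ] [Fintype Λ]

variable {A : Matrix Λ Λ ℂ} {c : ℝ}

/-! #### Bosonic pieces -/

omit [LinearOrder Λ] in
/-- `e^{-(-ξ)A(-ξ)‾} = e^{-ξAξ̄}`. [folklore] -/
theorem gaussWeight_neg (A : Matrix Λ Λ ℂ) (ξ : Λ → ℂ) : Boson.gaussWeight A (-ξ) = Boson.gaussWeight A ξ := by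
  simp only [Boson.gaussWeight, Boson.quadForm, Pi.neg_apply, map_neg, neg_mul, mul_neg, neg_neg]

omit [LinearOrder Λ] in
/-- **Odd moments vanish**: `∫ ξ_x e^{-ξAξ̄} dξ = 0` (substitute `ξ ↦ -ξ`). [folklore] -/
theorem integral_coord_mul_gaussWeight (A : Matrix Λ Λ ℂ) (x : Λ) :
    ∫ ξ : Λ → ℂ, ξ x * Boson.gaussWeight A ξ = 0 := by
  have h := integral_neg_eq_self (fun ξ : Λ → ℂ => ξ x * Boson.gaussWeight A ξ) volume
  simp only [Pi.neg_apply, gaussWeight_neg, neg_mul, integral_neg] at h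
  linear_combination (-(1 : ℂ) / 2) * h

omit [LinearOrder Λ] in
/-- **Odd moments vanish**: `∫ ξ̄_x e^{-ξAξ̄} dξ = 0`. [folklore] -/
theorem integral_conj_coord_mul_gaussWeight (A : Matrix Λ Λ ℂ) (x : Λ) :
    ∫ ξ : Λ → ℂ, conj (ξ x) * Boson.gaussWeight A ξ = 0 := by
  have h := integral_neg_eq_self (fun ξ : Λ → ℂ => conj (ξ x) * Boson.gaussWeight A ξ) volume
  simp only [Pi.neg_apply, map_neg, gaussWeight_neg, neg_mul, integral_neg] at h
  linear_combination (-(1 : ℂ) / 2) * h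

/-- `μ_C * z = z` for a constant. [folklore] -/
theorem gaussConvolution_const (h : RealPosDef A c) (z : ℂ) (φ : Λ → ℂ) :
    gaussConvolution A (constFun z) φ = z := by
  have hpi : (Real.pi : ℂ) ^ Fintype.card Λ ≠ 0 := pow_ne_zero _ (by exact_mod_cast Real.pi_ne_zero)
  simp only [gaussConvolution, constFun]
  rw [integral_const_mul, show (∫ ξ : Λ → ℂ, Boson.gaussWeight A ξ) = Boson.partitionFn A from rfl,
    partitionFn_eq h.pos h.bound]
  field_simp [h.isUnit_det.ne_zero]

/-- `μ_C *` is additive (integrable shifted functions). [folklore] -/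
theorem gaussConvolution_add (A : Matrix Λ Λ ℂ) {f g : FieldFun Λ} {φ : Λ → ℂ}
    (hf : Integrable fun ξ : Λ → ℂ => f (φ + ξ) * Boson.gaussWeight A ξ)
    (hg : Integrable fun ξ : Λ → ℂ => g (φ + ξ) * Boson.gaussWeight A ξ) :
    gaussConvolution A (f + g) φ = gaussConvolution A f φ + gaussConvolution A g φ := by
  simp only [gaussConvolution, Pi.add_apply, add_mul]
  rw [integral_add hf hg, mul_add]

/-- **The bosonic second moment: `μ_C * |φ_x|² = |φ_x|² + C_{xx}`** (`C = A⁻¹`; the cross terms are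
odd and vanish, `∫|ξ_x|² dμ_C = C_{xx}` by `twoPointFn_eq`). [cite: BrydgesImbrieSlade2009, Proposition 4.1, eq. (2.11)] -/
theorem gaussConvolution_normSq (h : RealPosDef A c) (x : Λ) (φ : Λ → ℂ) :
    gaussConvolution A (fun φ => φ x * conj (φ x)) φ = φ x * conj (φ x) + A⁻¹ x x := by
  classical
  have hpi : (Real.pi : ℂ) ^ Fintype.card Λ ≠ 0 := pow_ne_zero _ (by exact_mod_cast Real.pi_ne_zero)
  have hZ := det_mul_partitionFn_eq h.pos h.bound
  have h0 : Integrable fun ξ : Λ → ℂ => (1 : ℂ) * Boson.gaussWeight A ξ :=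
    Boson.integrable_mul_gaussWeight h.pos h.bound (by fun_prop) (M := 1) (k := 0) fun ξ => by simp
  simp only [one_mul] at h0
  have h1 : Integrable fun ξ : Λ → ℂ => ξ x * Boson.gaussWeight A ξ :=
    Boson.integrable_mul_gaussWeight h.pos h.bound (continuous_apply x).aestronglyMeasurable (M := 1) (k := 1)
      fun ξ => by simpa using (norm_le_pi_norm ξ x).trans (by linarith [norm_nonneg ξ])
  have h1' : Integrable fun ξ : Λ → ℂ => conj (ξ x) * Boson.gaussWeight A ξ :=
    Boson.integrable_mul_gaussWeight h.pos h.bound (Complex.continuous_conj.comp (continuous_apply x)).aestronglyMeasurable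
      (M := 1) (k := 1) fun ξ => by
      simpa [Complex.norm_conj] using (norm_le_pi_norm ξ x).trans (by linarith [norm_nonneg ξ])
  have h2 := Boson.integrable_conjCoord_mul_coord_mul_gaussWeight h.pos h.bound x x
  have hsplit : ∀ ξ : Λ → ℂ, (φ + ξ) x * conj ((φ + ξ) x) * Boson.gaussWeight A ξ =
      φ x * conj (φ x) * Boson.gaussWeight A ξ + φ x * (conj (ξ x) * Boson.gaussWeight A ξ) +
        conj (φ x) * (ξ x * Boson.gaussWeight A ξ) + conj (ξ x) * ξ x * Boson.gaussWeight A ξ := by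
    intro ξ; simp only [Pi.add_apply, map_add]; ring
  have hI2 : Integrable fun ξ : Λ → ℂ => φ x * conj (φ x) * Boson.gaussWeight A ξ +
      φ x * (conj (ξ x) * Boson.gaussWeight A ξ) := (h0.const_mul _).add (h1'.const_mul _)
  have hI3 : Integrable fun ξ : Λ → ℂ => φ x * conj (φ x) * Boson.gaussWeight A ξ +
      φ x * (conj (ξ x) * Boson.gaussWeight A ξ) + conj (φ x) * (ξ x * Boson.gaussWeight A ξ) := hI2.add (h1.const_mul _)
  simp only [gaussConvolution]
  simp_rw [hsplit]
  rw [integral_add hI3 h2, integral_add hI2 (h1.const_mul _), integral_add (h0.const_mul _) (h1'.const_mul _),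
    integral_const_mul, integral_const_mul, integral_const_mul,
    integral_coord_mul_gaussWeight, integral_conj_coord_mul_gaussWeight, mul_zero, mul_zero, add_zero, add_zero,
    show (∫ ξ : Λ → ℂ, conj (ξ x) * ξ x * Boson.gaussWeight A ξ) = Boson.twoPointFn A x x from rfl,
    Boson.twoPointFn_eq h.pos h.bound, show (∫ ξ : Λ → ℂ, Boson.gaussWeight A ξ) = Boson.partitionFn A from rfl,
    partitionFn_eq h.pos h.bound]
  field_simp [h.isUnit_det.ne_zero]

/-! #### Additivity of `E_Cθ` -/

/-- **`E_Cθ` is additive** on forms whose shifted coefficients are `e^{-ξAξ̄}`-integrable.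
[cite: BauerschmidtBrydgesSlade2015LogCorr, §4.1 ("extend this to a map θ : 𝒩 → 𝒩^× by linearity")] -/
theorem convTheta_add (A : Matrix Λ Λ ℂ) (hA : A.det ≠ 0) {F G : SForm Λ}
    (hF : ∀ (u : Finset (Λ ⊕ₗ Λ)) (φ : Λ → ℂ),
      Integrable fun ξ : Λ → ℂ => (grassmannBasis (FieldFun Λ) (Λ ⊕ₗ Λ)).repr F u (φ + ξ) * Boson.gaussWeight A ξ)
    (hG : ∀ (u : Finset (Λ ⊕ₗ Λ)) (φ : Λ → ℂ),
      Integrable fun ξ : Λ → ℂ => (grassmannBasis (FieldFun Λ) (Λ ⊕ₗ Λ)).repr G u (φ + ξ) * Boson.gaussWeight A ξ) :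
    convTheta A (F + G) = convTheta A F + convTheta A G := by
  have hFG : ∀ (u : Finset (Λ ⊕ₗ Λ)) (φ : Λ → ℂ), Integrable fun ξ : Λ → ℂ =>
      (grassmannBasis (FieldFun Λ) (Λ ⊕ₗ Λ)).repr (F + G) u (φ + ξ) * Boson.gaussWeight A ξ := by
    intro u φ
    simp only [map_add, Finsupp.add_apply, Pi.add_apply, add_mul]
    exact (hF u φ).add (hG u φ)
  rw [convTheta_eq_sum A hA F hF, convTheta_eq_sum A hA G hG, convTheta_eq_sum A hA (F + G) hFG,
    ← Finset.sum_add_distrib]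
  refine Finset.sum_congr rfl fun s _ => ?_
  refine Eq.trans ?_ (add_smul _ _ _)
  congr 1
  funext φ
  simp only [Pi.add_apply, map_add, Finsupp.add_apply, ← Finset.sum_add_distrib]
  refine Finset.sum_congr rfl fun u _ => ?_
  rw [show ((grassmannBasis (FieldFun Λ) (Λ ⊕ₗ Λ)).repr F u + (grassmannBasis (FieldFun Λ) (Λ ⊕ₗ Λ)).repr G u :
      FieldFun Λ) = (grassmannBasis (FieldFun Λ) (Λ ⊕ₗ Λ)).repr F u + (grassmannBasis (FieldFun Λ) (Λ ⊕ₗ Λ)).repr G u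
      from rfl, gaussConvolution_add A (hF u φ) (hG u φ)]
  ring

/-! #### `E_Cθ` on forms with constant coefficients: the fermionic convolution -/

/-- **`E_Cθ` on a form with constant coefficients is the normalised fermionic convolution**:
`E_Cθ g = (ε det A)⁻¹ Γ_{Aᵀ} g` coefficientwise. [cite: BauerschmidtBrydgesSlade2015LogCorr, §4.1, eqs. (4.21)-(4.23)] -/
theorem convTheta_coeffMap_constHom (h : RealPosDef A c) (g : GrassmannAlgebra ℂ (Λ ⊕ₗ Λ)) :
    convTheta A (coeffMap constHom g) = ∑ s : Finset (Λ ⊕ₗ Λ),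
      constFun (Λ := Λ) (orientSign Λ * (A.det)⁻¹ * (grassmannBasis ℂ (DGen Λ)).repr
        (gaussConvOn ℂ (blockPsi Λ) (blockEta Λ) A.transpose
          (ExteriorAlgebra.map (Function.ExtendByZero.linearMap ℂ (blockPsi Λ)) g)) (s.map (blockPsi Λ).toEmbedding)) •
        grassmannBasis (FieldFun Λ) (Λ ⊕ₗ Λ) s := by
  have hrepr : ∀ u, (grassmannBasis (FieldFun Λ) (Λ ⊕ₗ Λ)).repr (coeffMap constHom g) u =
      constFun ((grassmannBasis ℂ (Λ ⊕ₗ Λ)).repr g u) := fun u => GrassmannAlgebra.repr_coeffMap _ g u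
  have hint : ∀ (u : Finset (Λ ⊕ₗ Λ)) (φ : Λ → ℂ), Integrable fun ξ : Λ → ℂ =>
      (grassmannBasis (FieldFun Λ) (Λ ⊕ₗ Λ)).repr (coeffMap constHom g) u (φ + ξ) * Boson.gaussWeight A ξ := by
    intro u φ
    simp only [hrepr, constFun]
    exact Boson.integrable_mul_gaussWeight h.pos h.bound (by fun_prop) (M := ‖(grassmannBasis ℂ (Λ ⊕ₗ Λ)).repr g u‖)
      (k := 0) fun ξ => by simp
  rw [convTheta_eq_sum A h.isUnit_det.ne_zero _ hint]
  refine Finset.sum_congr rfl fun s _ => ?_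
  congr 1
  funext φ
  -- the fermionic convolution of `g` expanded in monomials
  have hexp : ExteriorAlgebra.map (Function.ExtendByZero.linearMap ℂ (blockPsi Λ)) g =
      ∑ u : Finset (Λ ⊕ₗ Λ), (grassmannBasis ℂ (Λ ⊕ₗ Λ)).repr g u •
        grassmannBasis ℂ (DGen Λ) (u.map (blockPsi Λ).toEmbedding) := by
    conv_lhs => rw [← (grassmannBasis ℂ (Λ ⊕ₗ Λ)).sum_repr g]
    rw [map_sum]
    refine Finset.sum_congr rfl fun u _ => ?_
    rw [map_smul, GrassmannAlgebra.map_extendByZero_grassmannBasis]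
  simp only [hrepr, gaussConvolution_const h, constFun, hexp, gaussConvOn_sum_smul, map_sum, map_smul,
    Finsupp.coe_finsetSum, Finset.sum_apply, Finsupp.smul_apply, smul_eq_mul, Finset.mul_sum, fermiKernel]
  exact Finset.sum_congr rfl fun u _ => by ring

/-- The `ψ`-block generators are spectators for the `η`-integration. [folklore] -/
theorem gen_blockPsi_mem_spectatorSubalgebra (R : Type*) [CommRing R] (k : Λ ⊕ₗ Λ) :
    gen R (blockPsi Λ k) ∈ GrassmannAlgebra.spectatorSubalgebra R (etaSet Λ) :=
  GrassmannAlgebra.gen_mem_spectatorSubalgebra R (blockPsi_not_mem_etaSet k)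

/-- **The fermionic convolution of `ψ_xψ̄_x`**:
`Γ_{Aᵀ}(ψ_xψ̄_x) = ∫dη̄dη e^{η̄Aᵀη}(ψ_x+η_x)(ψ̄_x+η̄_x) = (ε det A) ψ_xψ̄_x - ε adj(A)_{xx}` — the odd
terms vanish by the `U(1)` charge rule, `∫ e^{η̄Aᵀη} = ε det A`, `∫ e^{η̄Aᵀη} η_xη̄_x = -ε adj(A)_{xx}`.
[cite: BrydgesImbrieSlade2009, Proposition 4.1, eq. (Efac) with p = 1] -/
theorem gaussConvOn_psi_mul_psiBar (A : Matrix Λ Λ ℂ) (x : Λ) :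
    gaussConvOn ℂ (blockPsi Λ) (blockEta Λ) A.transpose
        (ExteriorAlgebra.map (Function.ExtendByZero.linearMap ℂ (blockPsi Λ)) (psi ℂ x * psiBar ℂ x)) =
      (orientSign Λ * A.det) • ExteriorAlgebra.map (Function.ExtendByZero.linearMap ℂ (blockPsi Λ)) (psi ℂ x * psiBar ℂ x) -
        algebraMap ℂ _ (orientSign Λ * A.adjugate x x) := by
  -- the transported `ψ_xψ̄_x` and `η`-generators
  have hP : ExteriorAlgebra.map (Function.ExtendByZero.linearMap ℂ (blockPsi Λ)) (psi ℂ x * psiBar ℂ x) = gen ℂ (blockPsi Λ (toLex (Sum.inr x))) * gen ℂ (blockPsi Λ (toLex (Sum.inl x))) := by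
    unfold psi psiBar
    rw [map_mul]
    congr 1
    · exact GrassmannAlgebra.map_extendByZero_gen' ℂ (blockPsi Λ) _
    · exact GrassmannAlgebra.map_extendByZero_gen' ℂ (blockPsi Λ) _
  have hEta : ∀ k : Λ ⊕ₗ Λ, gen ℂ (blockEta Λ k) = ExteriorAlgebra.map (Function.ExtendByZero.linearMap ℂ (blockEta Λ)) (gen ℂ k) :=
    fun k => (GrassmannAlgebra.map_extendByZero_gen' ℂ (blockEta Λ) k).symm
  have hcomm : ∀ z, Commute (ExteriorAlgebra.map (Function.ExtendByZero.linearMap ℂ (blockEta Λ)) (grassmannExp (quadratic ℂ A.transpose))) z := commute_map_extend_grassmannExp_quadratic ℂ (blockEta Λ) A.transpose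
  have hPbspec : gen ℂ (blockPsi Λ (toLex (Sum.inr x))) ∈ GrassmannAlgebra.spectatorSubalgebra ℂ (etaSet Λ) := gen_blockPsi_mem_spectatorSubalgebra ℂ _
  have hPaspec : gen ℂ (blockPsi Λ (toLex (Sum.inl x))) ∈ GrassmannAlgebra.spectatorSubalgebra ℂ (etaSet Λ) := gen_blockPsi_mem_spectatorSubalgebra ℂ _
  -- the Gaussian integral and the three moments of the `η`-block
  have hZ : berezinOn ℂ (etaSet Λ) (ExteriorAlgebra.map (Function.ExtendByZero.linearMap ℂ (blockEta Λ)) (grassmannExp (quadratic ℂ A.transpose))) = algebraMap ℂ _ (orientSign Λ * A.det) := by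
    rw [etaSet, GrassmannAlgebra.berezinOn_map_extendByZero, berezin_grassmannExp_quadratic_holds ℂ (ι := Λ) A.transpose,
      Matrix.det_transpose, orientSign]
  have hodd_a : berezinOn ℂ (etaSet Λ) (ExteriorAlgebra.map (Function.ExtendByZero.linearMap ℂ (blockEta Λ)) (grassmannExp (quadratic ℂ A.transpose)) * gen ℂ (blockEta Λ (toLex (Sum.inl x)))) = 0 := by
    have hw := berezin_grassmannExp_quadratic_mul_word_eq_zero ℂ A.transpose [(x, true)] (by simp)
    simp only [List.map_cons, List.map_nil, if_true, List.prod_cons, List.prod_nil, mul_one] at hw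
    rw [hEta, ← map_mul, etaSet, GrassmannAlgebra.berezinOn_map_extendByZero]
    change algebraMap ℂ _ (berezin ℂ (Λ ⊕ₗ Λ) (grassmannExp (quadratic ℂ A.transpose) * psiBar ℂ x)) = 0
    rw [hw, map_zero]
  have hodd_b : berezinOn ℂ (etaSet Λ) (ExteriorAlgebra.map (Function.ExtendByZero.linearMap ℂ (blockEta Λ)) (grassmannExp (quadratic ℂ A.transpose)) * gen ℂ (blockEta Λ (toLex (Sum.inr x)))) = 0 := by
    have hw := berezin_grassmannExp_quadratic_mul_word_eq_zero ℂ A.transpose [(x, false)] (by simp)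
    simp only [List.map_cons, List.map_nil, List.prod_cons, List.prod_nil, mul_one, Bool.false_eq_true, if_false] at hw
    rw [hEta, ← map_mul, etaSet, GrassmannAlgebra.berezinOn_map_extendByZero]
    change algebraMap ℂ _ (berezin ℂ (Λ ⊕ₗ Λ) (grassmannExp (quadratic ℂ A.transpose) * psi ℂ x)) = 0
    rw [hw, map_zero]
  have htwo : berezinOn ℂ (etaSet Λ) (ExteriorAlgebra.map (Function.ExtendByZero.linearMap ℂ (blockEta Λ)) (grassmannExp (quadratic ℂ A.transpose)) * (gen ℂ (blockEta Λ (toLex (Sum.inr x))) * gen ℂ (blockEta Λ (toLex (Sum.inl x))))) = -algebraMap ℂ _ (orientSign Λ * A.adjugate x x) := by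
    have h2 := berezin_grassmannExp_quadratic_mul_psiBar_mul_psi ℂ A.transpose x x
    rw [hEta (toLex (Sum.inr x)), hEta (toLex (Sum.inl x)), ← map_mul, ← map_mul, etaSet,
      GrassmannAlgebra.berezinOn_map_extendByZero]
    change algebraMap ℂ _ (berezin ℂ (Λ ⊕ₗ Λ) (grassmannExp (quadratic ℂ A.transpose) * (psi ℂ x * psiBar ℂ x))) = _
    rw [psi_mul_psiBar ℂ x x, mul_neg, map_neg, h2, ← Matrix.adjugate_transpose, Matrix.transpose_apply, map_neg, orientSign]
  -- expand `(ψ_x + η_x)(ψ̄_x + η̄_x)` and integrate term by term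
  have hexpand : ExteriorAlgebra.map (Function.ExtendByZero.linearMap ℂ (blockEta Λ)) (grassmannExp (quadratic ℂ A.transpose)) * ((gen ℂ (blockPsi Λ (toLex (Sum.inr x))) + gen ℂ (blockEta Λ (toLex (Sum.inr x)))) * (gen ℂ (blockPsi Λ (toLex (Sum.inl x))) + gen ℂ (blockEta Λ (toLex (Sum.inl x))))) =
      gen ℂ (blockPsi Λ (toLex (Sum.inr x))) * gen ℂ (blockPsi Λ (toLex (Sum.inl x))) * ExteriorAlgebra.map (Function.ExtendByZero.linearMap ℂ (blockEta Λ)) (grassmannExp (quadratic ℂ A.transpose)) + gen ℂ (blockPsi Λ (toLex (Sum.inr x))) * (ExteriorAlgebra.map (Function.ExtendByZero.linearMap ℂ (blockEta Λ)) (grassmannExp (quadratic ℂ A.transpose)) * gen ℂ (blockEta Λ (toLex (Sum.inl x)))) + -(gen ℂ (blockPsi Λ (toLex (Sum.inl x))) * (ExteriorAlgebra.map (Function.ExtendByZero.linearMap ℂ (blockEta Λ)) (grassmannExp (quadratic ℂ A.transpose)) * gen ℂ (blockEta Λ (toLex (Sum.inr x))))) + ExteriorAlgebra.map (Function.ExtendByZero.linearMap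 ℂ (blockEta Λ)) (grassmannExp (quadratic ℂ A.transpose)) * (gen ℂ (blockEta Λ (toLex (Sum.inr x))) * gen ℂ (blockEta Λ (toLex (Sum.inl x)))) := by
    have h1 : ExteriorAlgebra.map (Function.ExtendByZero.linearMap ℂ (blockEta Λ)) (grassmannExp (quadratic ℂ A.transpose)) * (gen ℂ (blockPsi Λ (toLex (Sum.inr x))) * gen ℂ (blockPsi Λ (toLex (Sum.inl x)))) = gen ℂ (blockPsi Λ (toLex (Sum.inr x))) * gen ℂ (blockPsi Λ (toLex (Sum.inl x))) * ExteriorAlgebra.map (Function.ExtendByZero.linearMap ℂ (blockEta Λ)) (grassmannExp (quadratic ℂ A.transpose)) := (hcomm _).eq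
    have h2 : ExteriorAlgebra.map (Function.ExtendByZero.linearMap ℂ (blockEta Λ)) (grassmannExp (quadratic ℂ A.transpose)) * (gen ℂ (blockPsi Λ (toLex (Sum.inr x))) * gen ℂ (blockEta Λ (toLex (Sum.inl x)))) = gen ℂ (blockPsi Λ (toLex (Sum.inr x))) * (ExteriorAlgebra.map (Function.ExtendByZero.linearMap ℂ (blockEta Λ)) (grassmannExp (quadratic ℂ A.transpose)) * gen ℂ (blockEta Λ (toLex (Sum.inl x)))) := by
      rw [← mul_assoc, (hcomm _).eq, mul_assoc]
    have h3 : ExteriorAlgebra.map (Function.ExtendByZero.linearMap ℂ (blockEta Λ)) (grassmannExp (quadratic ℂ A.transpose)) * (gen ℂ (blockEta Λ (toLex (Sum.inr x))) * gen ℂ (blockPsi Λ (toLex (Sum.inl x)))) = -(gen ℂ (blockPsi Λ (toLex (Sum.inl x))) * (ExteriorAlgebra.map (Function.ExtendByZero.linearMap ℂ (blockEta Λ)) (grassmannExp (quadratic ℂ A.transpose)) * gen ℂ (blockEta Λ (toLex (Sum.inr x))))) := by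
      rw [show gen ℂ (blockEta Λ (toLex (Sum.inr x))) * gen ℂ (blockPsi Λ (toLex (Sum.inl x))) = -(gen ℂ (blockPsi Λ (toLex (Sum.inl x))) * gen ℂ (blockEta Λ (toLex (Sum.inr x)))) from eq_neg_of_add_eq_zero_left (ExteriorAlgebra.ι_add_mul_swap _ _),
        mul_neg, ← mul_assoc, (hcomm _).eq, mul_assoc]
    rw [add_mul, mul_add, mul_add, mul_add, mul_add, mul_add, h1, h2, h3]
    abel
  rw [gaussConvOn, hP, map_mul (ExteriorAlgebra.map (1 + fieldShift ℂ (blockPsi Λ) (blockEta Λ))),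
    map_one_add_fieldShift_gen_range, map_one_add_fieldShift_gen_range,
    show Finset.univ.map (blockEta Λ).toEmbedding = etaSet Λ from rfl, hexpand, map_add, map_add, map_add, map_neg,
    GrassmannAlgebra.berezinOn_mul_of_mem_spectatorSubalgebra ℂ (Subalgebra.mul_mem _ hPbspec hPaspec),
    GrassmannAlgebra.berezinOn_mul_of_mem_spectatorSubalgebra ℂ hPbspec,
    GrassmannAlgebra.berezinOn_mul_of_mem_spectatorSubalgebra ℂ hPaspec, hZ, hodd_a, hodd_b, htwo, mul_zero, mul_zero,
    neg_zero, add_zero, add_zero, ← Algebra.commutes, ← Algebra.smul_def, sub_eq_add_neg]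

/-- `ψ_xψ̄_x` over `FieldFun Λ` is the constant-coefficient image of `ψ_xψ̄_x` over `ℂ`. [folklore] -/
theorem psi_mul_psiBar_eq_coeffMap (x : Λ) :
    psi (FieldFun Λ) x * psiBar (FieldFun Λ) x = coeffMap constHom (psi ℂ x * psiBar ℂ x) := by
  rw [map_mul, GrassmannAlgebra.coeffMap_psi_gen, GrassmannAlgebra.coeffMap_psiBar_gen]

/-- **`E_Cθ(ψ_xψ̄_x) = ψ_xψ̄_x - C_{xx}`** (`C = A⁻¹`; the fermionic fluctuation two-point function
enters with a minus sign). [cite: BrydgesImbrieSlade2009, Proposition 4.1 (∫ e^{-S_A} ψ̄_yψ_x = C_{yx})] -/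
theorem convTheta_psi_mul_psiBar (h : RealPosDef A c) (x : Λ) :
    convTheta A (psi (FieldFun Λ) x * psiBar (FieldFun Λ) x) =
      psi (FieldFun Λ) x * psiBar (FieldFun Λ) x - ofFun (constFun (A⁻¹ x x)) := by
  classical
  have hdet : A.det ≠ 0 := h.isUnit_det.ne_zero
  have hε : orientSign Λ * orientSign Λ = 1 := orientSign_mul_self Λ
  rw [psi_mul_psiBar_eq_coeffMap, convTheta_coeffMap_constHom h]
  simp_rw [gaussConvOn_psi_mul_psiBar, map_sub, Finsupp.sub_apply, map_smul, Finsupp.smul_apply,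
    GrassmannAlgebra.repr_map_extendByZero_map, smul_eq_mul]
  -- the coefficient of `1`
  have hone : ∀ s : Finset (Λ ⊕ₗ Λ), (grassmannBasis ℂ (DGen Λ)).repr (algebraMap ℂ _ (orientSign Λ * A.adjugate x x))
      (s.map (blockPsi Λ).toEmbedding) = if s = ∅ then orientSign Λ * A.adjugate x x else 0 := by
    intro s
    rw [Algebra.algebraMap_eq_smul_one, map_smul, Finsupp.smul_apply, ← GrassmannAlgebra.grassmannBasis_empty,
      Module.Basis.repr_self, Finsupp.single_apply, smul_eq_mul]
    by_cases hs : s = ∅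
    · subst hs; simp
    · rw [if_neg (fun h' => hs (Finset.map_eq_empty.1 h'.symm)), if_neg hs, mul_zero]
  simp_rw [hone]
  -- reassemble: the `ψψ̄`-part is `coeffMap constHom (ψψ̄)`, the constant part is `C_xx · 1`
  have hsplit : ∀ s : Finset (Λ ⊕ₗ Λ),
      constFun (Λ := Λ) (orientSign Λ * (A.det)⁻¹ * (orientSign Λ * A.det * (grassmannBasis ℂ (Λ ⊕ₗ Λ)).repr
        (psi ℂ x * psiBar ℂ x) s - if s = ∅ then orientSign Λ * A.adjugate x x else 0)) •
        grassmannBasis (FieldFun Λ) (Λ ⊕ₗ Λ) s =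
      constFun (Λ := Λ) ((grassmannBasis ℂ (Λ ⊕ₗ Λ)).repr (psi ℂ x * psiBar ℂ x) s) • grassmannBasis (FieldFun Λ) (Λ ⊕ₗ Λ) s -
        constFun (Λ := Λ) (if s = ∅ then A⁻¹ x x else 0) • grassmannBasis (FieldFun Λ) (Λ ⊕ₗ Λ) s := by
    intro s
    rw [← sub_smul]
    congr 1
    funext φ
    simp only [constFun, Pi.sub_apply]
    have hd : (A.det)⁻¹ * A.det = 1 := inv_mul_cancel₀ hdet
    split_ifs
    · rw [adjugate_apply_eq_det_mul_inv h.isUnit_det]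
      linear_combination ((A.det)⁻¹ * A.det * ((grassmannBasis ℂ (Λ ⊕ₗ Λ)).repr (psi ℂ x * psiBar ℂ x) s - A⁻¹ x x)) * hε + ((grassmannBasis ℂ (Λ ⊕ₗ Λ)).repr (psi ℂ x * psiBar ℂ x) s - A⁻¹ x x) * hd
    · linear_combination ((A.det)⁻¹ * A.det * (grassmannBasis ℂ (Λ ⊕ₗ Λ)).repr (psi ℂ x * psiBar ℂ x) s) * hε + ((grassmannBasis ℂ (Λ ⊕ₗ Λ)).repr (psi ℂ x * psiBar ℂ x) s) * hd
  simp_rw [hsplit]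
  have hX : ∑ s : Finset (Λ ⊕ₗ Λ), constFun (Λ := Λ) ((grassmannBasis ℂ (Λ ⊕ₗ Λ)).repr (psi ℂ x * psiBar ℂ x) s) •
      grassmannBasis (FieldFun Λ) (Λ ⊕ₗ Λ) s = psi (FieldFun Λ) x * psiBar (FieldFun Λ) x := by
    rw [psi_mul_psiBar_eq_coeffMap, GrassmannAlgebra.coeffMap_apply]
    rfl
  have hY : ∑ s : Finset (Λ ⊕ₗ Λ), constFun (Λ := Λ) (if s = ∅ then A⁻¹ x x else 0) • grassmannBasis (FieldFun Λ) (Λ ⊕ₗ Λ) s =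
      ofFun (constFun (A⁻¹ x x)) := by
    rw [Finset.sum_eq_single (∅ : Finset (Λ ⊕ₗ Λ)) (fun s _ hs => by rw [if_neg hs]; exact zero_smul _ _)
      (fun h' => absurd (Finset.mem_univ _) h'), if_pos rfl, GrassmannAlgebra.grassmannBasis_empty, ofFun,
      Algebra.algebraMap_eq_smul_one]
  rw [Finset.sum_sub_distrib, hX, hY, psi_mul_psiBar_eq_coeffMap]

/-! #### `E_Cθ τ_x = τ_x` -/

/-- Coordinates of a `0`-form of `𝒩`: only the empty monomial. [folklore] -/
theorem repr_ofFun (f : FieldFun Λ) (t : Finset (Λ ⊕ₗ Λ)) :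
    (grassmannBasis (FieldFun Λ) (Λ ⊕ₗ Λ)).repr (ofFun f) t = if t = ∅ then f else 0 := by
  classical
  rw [ofFun, Algebra.algebraMap_eq_smul_one, map_smul, Finsupp.smul_apply, smul_eq_mul,
    ← GrassmannAlgebra.grassmannBasis_empty, Module.Basis.repr_self, Finsupp.single_apply]
  by_cases ht : t = ∅
  · subst ht; simp
  · rw [if_neg (Ne.symm ht), if_neg ht, mul_zero]

/-- **`E_Cθ τ_x = τ_x`**: the Gaussian super-convolution fixes the supersymmetric form
`τ_x = φ_xφ̄_x + ψ_xψ̄_x` — the bosonic fluctuation `+C_{xx}` (`gaussConvolution_normSq`) and the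
fermionic one `-C_{xx}` (`convTheta_psi_mul_psiBar`) cancel ([BIS09] (F0): `∫ e^{-S_A} τ_x = 0`).
[cite: BrydgesImbrieSlade2009, Proposition 4.4, eq. (F0) (case F(t) = t_x)] -/
theorem convTheta_tau (h : RealPosDef A c) (x : Λ) : convTheta A (tau x) = tau x := by
  classical
  have hdet : A.det ≠ 0 := h.isUnit_det.ne_zero
  -- integrability of the shifted coefficients of the two summands of `τ_x`
  have hF : ∀ (u : Finset (Λ ⊕ₗ Λ)) (φ : Λ → ℂ), Integrable fun ξ : Λ → ℂ =>
      (grassmannBasis (FieldFun Λ) (Λ ⊕ₗ Λ)).repr (ofFun fun φ : Λ → ℂ => φ x * conj (φ x)) u (φ + ξ) *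
        Boson.gaussWeight A ξ := by
    intro u φ
    simp only [repr_ofFun]
    split_ifs
    · exact integrable_shift_mul_gaussWeight h (f := fun φ : Λ → ℂ => φ x * conj (φ x)) (by fun_prop) (K := 1) (k := 2)
        (fun φ' => by
          rw [norm_mul, Complex.norm_conj, one_mul, ← sq]
          have h1 : ‖φ' x‖ ≤ ‖φ'‖ := norm_le_pi_norm φ' x
          nlinarith [norm_nonneg (φ' x), norm_nonneg φ']) φ
    · simp only [Pi.zero_apply, zero_mul]
      exact integrable_zero _ _ _
  have hG : ∀ (u : Finset (Λ ⊕ₗ Λ)) (φ : Λ → ℂ), Integrable fun ξ : Λ → ℂ =>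
      (grassmannBasis (FieldFun Λ) (Λ ⊕ₗ Λ)).repr (psi (FieldFun Λ) x * psiBar (FieldFun Λ) x) u (φ + ξ) *
        Boson.gaussWeight A ξ := by
    intro u φ
    rw [psi_mul_psiBar_eq_coeffMap]
    simp only [GrassmannAlgebra.repr_coeffMap, constHom_apply]
    exact Boson.integrable_mul_gaussWeight h.pos h.bound (by fun_prop)
      (M := ‖(grassmannBasis ℂ (Λ ⊕ₗ Λ)).repr (psi ℂ x * psiBar ℂ x) u‖) (k := 0) fun ξ => by simp
  rw [tau, convTheta_add A hdet hF hG, convTheta_ofFun, convTheta_psi_mul_psiBar h,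
    show gaussConvolution A (fun φ : Λ → ℂ => φ x * conj (φ x)) = (fun φ : Λ → ℂ => φ x * conj (φ x)) + constFun (A⁻¹ x x)
      from funext fun φ => by rw [gaussConvolution_normSq h x φ]; rfl, ofFun, map_add]
  unfold ofFun
  abel

end TauCheck

end CTWSAW

end Literature.Barriers.CriticalPhenomena
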